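import Summits.BirchSwinnertonDyer.BirchSwinnertonDyer.Theorems.SignedLowerHalvesSmallImageCharSignedSelmerSatDefs
import Summits.BirchSwinnertonDyer.BirchSwinnertonDyer.Theorems.ResidualThetaTransportAtTwoLambdaLeCardQuotient
import Literature.NumberTheory.EllipticCurves.IwasawaNakayamaProofs
import Literature.NumberTheory.EllipticCurves.IwasawaModuleFinitePadicIntProofs
import Literature.NumberTheory.EllipticCurves.CharacterModuleQuotientDualityProofs
import Literature.NumberTheory.EllipticCurves.IwasawaEulerCharDualityProofs
import HarnessLib

/-!
# Route `SignedLowerHalves`, crux L `SmallImageLowerHalfBothSigns` (stmt-BirchSwinnertonDyer-23599), line `rtt_w3` v9 —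
# brick E1-alg of the residual signed transfer E1: the `Λ`-ALGEBRA HALF. For ANY saturated signed transport dual datum
# `Dψ` (carrier D1-T′, `Theorems/SignedLowerHalvesSmallImageCharSignedSelmerDefs` / `…SatDefs`), finiteness of the
# `p`-torsion of the Selmer group it dualises gives, in the kernel: `Dψ.X` finitely generated over `Λ = ℤ_p⟦T⟧`,
# `Λ`-torsion, `μ(Dψ.X) = 0`, and `λ(Dψ.X) ≤ N` as soon as `#Sel[p] ≤ p^N`.

LEAD `cruxlead-stmt-BirchSwinnertonDyer-23599` g6 (cell `bsd-ssimc`; `--supports stmt-BirchSwinnertonDyer-23599 --as helper`).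
THEOREMS ONLY (no definition, no named fact, no instance, no `sorry`); nothing here is specific to the character `ψ`, to the
curve `W` or to the sign; BSD / crux L / E1 are NOT proved by this file.

WHY (memo `Lines/rtt_w3-BRIEF-v8-g5.md` §3/§7, registered stub `stub_charRoad_ns`, conjunct E1 = hypothesis `hE1` of the landed glue
`SmallImageRttCharRoad.psbTheta_of_charRoad`, p760663): E1 concludes, for the dual `Dψ.X` of the saturated transported signed Selmer
group `Sel^{ε,S₀K}_𝒪(K_∞, (F/𝒪)(ψ_𝔭))`, `Module.Finite Λ Dψ.X ∧ Module.IsTorsion Λ Dψ.X ∧ lambdaInvariant p Dψ.X ≤ e·(λ(X^ε_W) + Σ_{S₀} δ_W)`.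
Its research content is RESIDUAL: a count `#Sel^{ε,S₀K}_𝒪(K_∞, M)[p] ≤ p^{e·(λ(X^ε_W)+Σδ_W)}` (Shapiro transport of the residual Selmer
groups `W[p] ⊗ k' ↔ k'(θ̄)`, B2/B3/B3′ landed; B. D. Kim's control; Greenberg–Vatsal). THIS FILE is everything AFTER the count, once and for
all: E1 ⟸ (the count) by `SignedTransportDualDataSat.finite_torsion_lambda_le_of_card_pTorsion_le`.

WHAT (`Dψ : SignedTransportDualDataSat κ γ M R V j S₀ ε`, `M` `p`-primary with open stabilisers, `γ` a topological generator of
`Γ = Gal(K_∞/K)`; `Sel := signedTransportSelmerInftySat κ M R V j S₀ ε`):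
* §1 `SignedTransportDualDataSat.isDualPair` — `(Dψ.X, Dψ.toDual)` is an axiomatic Pontryagin dual pair for `ψ = conj_γ − 1`
  (tree `IwasawaDual.IsDualPair`; local nilpotence = the carrier's `isLocNil_conjSignedSat_sub_one`);
  **`moduleFinite_of_finite_pTorsion`** — `Sel[p]` finite ⇒ `Dψ.X` finitely generated over `Λ` (Nakayama for Pontryagin duals,
  tree `IwasawaDual.IsDualPair.module_finite`: `Sel[𝔪] ⊆ Sel[p]`).
* §2 `toDual_C_natCast_smul` — the constant `p ∈ Λ` acts on `Dψ.X` as the transpose of multiplication by `p` on `Sel`;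
  `exists_quotient_augIdealP_addEquiv` — **`Dψ.X/(p)·Dψ.X ≃+ Hom(Sel[p], ℚ/ℤ)`** (tree `PontryaginCard.exists_quotSMulTop_addEquiv_characterModule_ker`);
  `finite_quotient_augIdealP_of_finite_pTorsion`, `natCard_quotient_augIdealP_eq` (`#(X/(p)X) = #Sel[p]`).
* §3 **`isTorsion_of_finite_pTorsion`**, **`muInvariant_eq_zero_of_finite_pTorsion`**, **`moduleFinite_padicInt_of_finite_pTorsion`**
  (tree `IwasawaModuleFinitePadicInt.*_of_finite_quotient_augIdealP`: `X` f.g. with `X/(p)X` finite is torsion with `μ = 0`, hence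
  f.g. over `ℤ_p`); **`pow_lambdaInvariant_le_card_pTorsion`** — `p^{λ(Dψ.X)} ≤ #Sel[p]` (tree `LambdaLowerBound.pow_lambdaInvariant_le_natCard_quotient`,
  `λ = rank_{ℤ_p}`); and the E1-shaped package **`finite_torsion_lambda_le_of_card_pTorsion_le`**:
  `Sel[p]` finite ∧ `#Sel[p] ≤ p^N` ⇒ `Module.Finite Λ Dψ.X ∧ Module.IsTorsion Λ Dψ.X ∧ lambdaInvariant p Dψ.X ≤ N`.

References: [GreenbergLNM1716] §1 p. 60 (Nakayama for `X = Sel^∨`), §4 p. 98 (`X/θX` dual to the `θ`-torsion); [GreenbergVatsal2000] §2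
Prop. (2.8) (`μ = 0` iff `Sel[p]` finite, `λ = dim Sel[p]` then); [Washington1997] §13.2; [EmertonPollackWeston2006] Thm. 3.1.1.
-/

set_option autoImplicit false
set_option linter.dupNamespace false -- D-0017: single-problem summit, the namespace repeats the problem name by design
noncomputable section

open scoped Classical
open NumberField IsDedekindDomain Field

universe u

namespace Summit.BirchSwinnertonDyer.BirchSwinnertonDyer.Theorems.SmallImageCharSignedSelmer

open Literature.NumberTheory.EllipticCurves Literature.NumberTheory.EllipticCurves.IwasawaAlgebra
  Literature.NumberTheory.GaloisRepresentations

variable {K : Type u} [Field K] [NumberField K] {p : ℕ} [Fact p.Prime] {κ : ZpExtension K p} {γ : absoluteGaloisGroup K}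
  {M : Type u} [AddCommGroup M] [DistribMulAction (absoluteGaloisGroup K) M] [TopologicalSpace M] [DiscreteTopology M]
  {R : Type*} [Ring R] [Module R M]
  {V : WeierstrassCurve K} {j : V.geomPrimaryTorsion p →+ M} {S₀ : Set (HeightOneSpectrum (𝓞 K))} {ε : ℤˣ}

namespace SignedTransportDualDataSat

/-! ## §1. The dual pair and Nakayama: `Sel[p]` finite ⇒ `X` finitely generated over `Λ` -/

/-- **`(Dψ.X, Dψ.toDual)` is a Pontryagin dual pair for `ψ = conj_γ − 1`** on `Sel^{ε,S₀}_R(K_∞, M)` (`T ↦ conj_γ − 1`, constants through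
`ℤ_p → ℤ/p^k`, `(p, conj_γ − 1)` locally nilpotent) when `M` is `p`-primary with open stabilisers and `γ` topologically generates `Γ`.
[cite: GreenbergLNM1716, §1 p. 60 (after Conj. 1.3)] -/
theorem isDualPair (D : SignedTransportDualDataSat κ γ M R V j S₀ ε) (htor : ∀ m : M, ∃ k : ℕ, p ^ k • m = 0)
    (hstab : ∀ m : M, IsOpen (MulAction.stabilizer (absoluteGaloisGroup K) m : Set (absoluteGaloisGroup K)))
    (hγ : κ.IsTopGenerator γ) :
    IwasawaDual.IsDualPair p (conjSignedSat κ M R V j S₀ ε γ - 1) D.toDual where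
  bijective := D.bijective
  T_smul x s := by
    rw [D.toDual_T_smul, IwasawaDual.End_sub_apply, AddMonoid.End.one_apply, map_sub]
    rfl
  C_smul c x s k hk := D.toDual_C_smul c x s k hk
  locNil := isLocNil_conjSignedSat_sub_one κ R V j S₀ ε htor hstab hγ

/-- **Nakayama for the dual: `Sel^{ε,S₀}_R(K_∞, M)[p]` finite ⇒ `Dψ.X` finitely generated over `Λ = ℤ_p⟦T⟧`** (the `𝔪 = (p, T)`-torsion
`Sel[𝔪]` lies in `Sel[p]`; tree `IwasawaDual.IsDualPair.module_finite`). [cite: GreenbergLNM1716, §1 p. 60 (after Conj. 1.3)] -/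
theorem moduleFinite_of_finite_pTorsion (D : SignedTransportDualDataSat κ γ M R V j S₀ ε)
    (htor : ∀ m : M, ∃ k : ℕ, p ^ k • m = 0)
    (hstab : ∀ m : M, IsOpen (MulAction.stabilizer (absoluteGaloisGroup K) m : Set (absoluteGaloisGroup K)))
    (hγ : κ.IsTopGenerator γ)
    (hfin : {s : signedTransportSelmerInftySat κ M R V j S₀ ε | p • s = 0}.Finite) :
    Module.Finite (IwasawaAlgebra p) D.X := by
  refine (D.isDualPair htor hstab hγ).module_finite ?_
  refine hfin.subset fun s hs ↦ ?_
  obtain ⟨hs1, -⟩ := hs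
  rw [pow_one] at hs1
  exact hs1

/-! ## §2. `X/(p)X` is the Pontryagin dual of `Sel[p]` -/

/-- Every class of `Sel^{ε,S₀}_R(K_∞, M)` is killed by a power of `p` (`M` is `p`-primary). [cite: GreenbergLNM1716, §1 (after Conj. 1.3)] -/
theorem exists_pow_smul_sel_eq_zero (htor : ∀ m : M, ∃ k : ℕ, p ^ k • m = 0)
    (s : signedTransportSelmerInftySat κ M R V j S₀ ε) : ∃ k : ℕ, p ^ k • s = 0 := by
  obtain ⟨k, hk⟩ := GreenbergSelmer.exists_pow_smul_subgroupH1_eq_zero κ M htor (s : subgroupH1 κ.kerSubgroup M)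
  exact ⟨k, Subtype.ext (by rw [AddSubgroupClass.coe_nsmul]; exact hk)⟩

/-- **The constant `p ∈ Λ` acts on `Dψ.X` as the transpose of multiplication by `p`**: `toDual (C p • x) s = toDual x (p • s)`
(from `toDual_C_smul` on the `p^k`-torsion class `s`: `(p mod p^k) • t = p • t` for `p^k t = 0`). [cite: GreenbergLNM1716, §1 p. 60] -/
theorem toDual_C_natCast_smul (D : SignedTransportDualDataSat κ γ M R V j S₀ ε) (htor : ∀ m : M, ∃ k : ℕ, p ^ k • m = 0)
    (x : D.X) (s : signedTransportSelmerInftySat κ M R V j S₀ ε) :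
    D.toDual (PowerSeries.C (p : ℤ_[p]) • x) s = D.toDual x (p • s) := by
  obtain ⟨k, hk⟩ := exists_pow_smul_sel_eq_zero (κ := κ) (R := R) (V := V) (j := j) (S₀ := S₀) (ε := ε) htor s
  rw [D.toDual_C_smul (p : ℤ_[p]) x s k hk, map_natCast, ZMod.val_natCast, map_nsmul]
  -- `p^k • toDual x s = 0`, so `(p mod p^k) • toDual x s = p • toDual x s`
  have hkt : p ^ k • D.toDual x s = 0 := by rw [← map_nsmul, hk, map_zero]
  have h : (p % p ^ k + p ^ k * (p / p ^ k)) • D.toDual x s = p • D.toDual x s := by rw [Nat.mod_add_div]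
  rw [add_nsmul, mul_nsmul, hkt, nsmul_zero, add_zero] at h
  exact h

/-- **`Dψ.X/(p)·Dψ.X ≃+ Hom(Sel[p], ℚ/ℤ)`**, `Sel[p] = ker (s ↦ p·s)`, evaluating as `[x] ↦ (a ↦ toDual x a)` (Greenberg: «`X/θX` is the
Pontryagin dual of the `θ`-torsion», with `θ = p`; tree `PontryaginCard.exists_quotSMulTop_addEquiv_characterModule_ker`).
[cite: GreenbergLNM1716, §4 p. 98] -/
theorem exists_quotient_augIdealP_addEquiv (D : SignedTransportDualDataSat κ γ M R V j S₀ ε)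
    (htor : ∀ m : M, ∃ k : ℕ, p ^ k • m = 0) :
    ∃ Ψ : (D.X ⧸ (augIdealP p • (⊤ : Submodule (IwasawaAlgebra p) D.X))) ≃+
        CharacterModule (DistribSMul.toAddMonoidHom (signedTransportSelmerInftySat κ M R V j S₀ ε) p).ker,
      ∀ (x : D.X) (a : (DistribSMul.toAddMonoidHom (signedTransportSelmerInftySat κ M R V j S₀ ε) p).ker),
        Ψ (Submodule.Quotient.mk x) a = D.toDual x a :=
  PontryaginCard.exists_quotSMulTop_addEquiv_characterModule_ker (D.toDual : D.X →+ CharacterModule _) D.bijective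
    (PowerSeries.C (p : ℤ_[p])) _ fun x s ↦ by
      rw [DistribSMul.toAddMonoidHom_apply]
      exact D.toDual_C_natCast_smul htor x s

/-- The kernel of multiplication by `p` on `Sel` IS the set `Sel[p] = {s | p·s = 0}` (bookkeeping). [folklore] -/
theorem coe_ker_toAddMonoidHom_eq :
    ((DistribSMul.toAddMonoidHom (signedTransportSelmerInftySat κ M R V j S₀ ε) p).ker : Set (signedTransportSelmerInftySat κ M R V j S₀ ε)) =
      {s : signedTransportSelmerInftySat κ M R V j S₀ ε | p • s = 0} := by
  ext s
  rw [SetLike.mem_coe, AddMonoidHom.mem_ker, DistribSMul.toAddMonoidHom_apply, Set.mem_setOf_eq]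

/-- **`#(Dψ.X/(p)·Dψ.X) = #Sel[p]`** (as `Nat.card`; both sides `0` when infinite). [cite: GreenbergLNM1716, §4 p. 98] -/
theorem natCard_quotient_augIdealP_eq (D : SignedTransportDualDataSat κ γ M R V j S₀ ε) (htor : ∀ m : M, ∃ k : ℕ, p ^ k • m = 0) :
    Nat.card (D.X ⧸ (augIdealP p • (⊤ : Submodule (IwasawaAlgebra p) D.X))) =
      Nat.card {s : signedTransportSelmerInftySat κ M R V j S₀ ε | p • s = 0} := by
  obtain ⟨Ψ, -⟩ := D.exists_quotient_augIdealP_addEquiv htor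
  rw [PontryaginCard.natCard_eq_of_addEquiv_characterModule Ψ, ← SetLike.coe_sort_coe, coe_ker_toAddMonoidHom_eq]

/-- **`Sel[p]` finite ⇒ `Dψ.X/(p)·Dψ.X` finite.** [cite: GreenbergLNM1716, §4 p. 98] -/
theorem finite_quotient_augIdealP_of_finite_pTorsion (D : SignedTransportDualDataSat κ γ M R V j S₀ ε)
    (htor : ∀ m : M, ∃ k : ℕ, p ^ k • m = 0)
    (hfin : {s : signedTransportSelmerInftySat κ M R V j S₀ ε | p • s = 0}.Finite) :
    Finite (D.X ⧸ (augIdealP p • (⊤ : Submodule (IwasawaAlgebra p) D.X))) := by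
  obtain ⟨Ψ, -⟩ := D.exists_quotient_augIdealP_addEquiv htor
  rw [PontryaginCard.finite_iff_of_addEquiv_characterModule Ψ, ← SetLike.coe_sort_coe, coe_ker_toAddMonoidHom_eq]
  exact hfin.to_subtype

/-! ## §3. Torsion, `μ = 0`, finite generation over `ℤ_p`, and `λ ≤ N` -/

/-- **`Sel[p]` finite ⇒ `Dψ.X` is `Λ`-torsion** (f.g. with `X/(p)X` finite: `T^k X ⊆ pX` and Cayley–Hamilton; tree
`IwasawaModuleFinitePadicInt.isTorsion_of_finite_quotient_augIdealP`). [cite: GreenbergLNM1716, §1 p. 61] [cite: GreenbergVatsal2000, §2 Prop. (2.8)] -/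
theorem isTorsion_of_finite_pTorsion (D : SignedTransportDualDataSat κ γ M R V j S₀ ε)
    (htor : ∀ m : M, ∃ k : ℕ, p ^ k • m = 0)
    (hstab : ∀ m : M, IsOpen (MulAction.stabilizer (absoluteGaloisGroup K) m : Set (absoluteGaloisGroup K)))
    (hγ : κ.IsTopGenerator γ)
    (hfin : {s : signedTransportSelmerInftySat κ M R V j S₀ ε | p • s = 0}.Finite) :
    Module.IsTorsion (IwasawaAlgebra p) D.X := by
  haveI := D.moduleFinite_of_finite_pTorsion htor hstab hγ hfin
  exact IwasawaModuleFinitePadicInt.isTorsion_of_finite_quotient_augIdealP p D.X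
    (D.finite_quotient_augIdealP_of_finite_pTorsion htor hfin)

/-- **`Sel[p]` finite ⇒ `μ(Dψ.X) = 0`** (Greenberg–Vatsal Prop. (2.8), `μ`-half; tree `IwasawaModuleFinitePadicInt.muInvariant_eq_zero_of_finite_quotient_augIdealP`).
[cite: GreenbergVatsal2000, §2 Prop. (2.8)] -/
theorem muInvariant_eq_zero_of_finite_pTorsion (D : SignedTransportDualDataSat κ γ M R V j S₀ ε)
    (htor : ∀ m : M, ∃ k : ℕ, p ^ k • m = 0)
    (hstab : ∀ m : M, IsOpen (MulAction.stabilizer (absoluteGaloisGroup K) m : Set (absoluteGaloisGroup K)))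
    (hγ : κ.IsTopGenerator γ)
    (hfin : {s : signedTransportSelmerInftySat κ M R V j S₀ ε | p • s = 0}.Finite) :
    muInvariant p D.X = 0 := by
  haveI := D.moduleFinite_of_finite_pTorsion htor hstab hγ hfin
  exact IwasawaModuleFinitePadicInt.muInvariant_eq_zero_of_finite_quotient_augIdealP p D.X
    (D.isTorsion_of_finite_pTorsion htor hstab hγ hfin) (D.finite_quotient_augIdealP_of_finite_pTorsion htor hfin)

/-- **`Sel[p]` finite ⇒ `Dψ.X` finitely generated over `ℤ_p`** (`μ = 0` and torsion; Washington §13.2; tree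
`IwasawaModuleFinitePadicInt.moduleFinite_padicInt_of_finite_quotient_augIdealP`). [cite: Washington1997, §13.2] [cite: GreenbergVatsal2000, §2 Prop. (2.8)] -/
theorem moduleFinite_padicInt_of_finite_pTorsion (D : SignedTransportDualDataSat κ γ M R V j S₀ ε)
    (htor : ∀ m : M, ∃ k : ℕ, p ^ k • m = 0)
    (hstab : ∀ m : M, IsOpen (MulAction.stabilizer (absoluteGaloisGroup K) m : Set (absoluteGaloisGroup K)))
    (hγ : κ.IsTopGenerator γ)
    (hfin : {s : signedTransportSelmerInftySat κ M R V j S₀ ε | p • s = 0}.Finite) :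
    Module.Finite ℤ_[p] (RestrictScalars ℤ_[p] (IwasawaAlgebra p) D.X) := by
  haveI := D.moduleFinite_of_finite_pTorsion htor hstab hγ hfin
  exact IwasawaModuleFinitePadicInt.moduleFinite_padicInt_of_finite_quotient_augIdealP p D.X
    (D.finite_quotient_augIdealP_of_finite_pTorsion htor hfin)

/-- **`p^{λ(Dψ.X)} ≤ #Sel[p]`** when `Sel[p]` is finite: `λ = rank_{ℤ_p}` of the finitely generated `ℤ_p`-module `X` and `p^{rank} ≤ #(X/pX) = #Sel[p]`
(tree `LambdaLowerBound.pow_lambdaInvariant_le_natCard_quotient`; equality would need «no finite `Λ`-submodule», not claimed).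
[cite: Washington1997, §13.2] [cite: EmertonPollackWeston2006, Thm. 3.1.1] -/
theorem pow_lambdaInvariant_le_card_pTorsion (D : SignedTransportDualDataSat κ γ M R V j S₀ ε)
    (htor : ∀ m : M, ∃ k : ℕ, p ^ k • m = 0)
    (hstab : ∀ m : M, IsOpen (MulAction.stabilizer (absoluteGaloisGroup K) m : Set (absoluteGaloisGroup K)))
    (hγ : κ.IsTopGenerator γ)
    (hfin : {s : signedTransportSelmerInftySat κ M R V j S₀ ε | p • s = 0}.Finite) :
    p ^ lambdaInvariant p D.X ≤ Nat.card {s : signedTransportSelmerInftySat κ M R V j S₀ ε | p • s = 0} := by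
  -- the compatible `ℤ_p`-structure on `X` (restriction of the `Λ`-structure along `ℤ_p → Λ`); `(c : ℤ_p) • x = C c • x` by `rfl`
  letI : Module ℤ_[p] D.X := Module.compHom D.X (algebraMap ℤ_[p] (IwasawaAlgebra p))
  haveI : IsScalarTower ℤ_[p] (IwasawaAlgebra p) D.X := IsScalarTower.of_compHom ℤ_[p] _ D.X
  haveI : Module.Finite ℤ_[p] D.X := D.moduleFinite_padicInt_of_finite_pTorsion htor hstab hγ hfin
  have hq' : ∀ (x : D.X) (s : signedTransportSelmerInftySat κ M R V j S₀ ε),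
      (D.toDual : D.X →+ CharacterModule _) ((p : ℤ_[p]) • x) s =
        (D.toDual : D.X →+ CharacterModule _) x (DistribSMul.toAddMonoidHom (signedTransportSelmerInftySat κ M R V j S₀ ε) p s) := by
    intro x s
    rw [DistribSMul.toAddMonoidHom_apply]
    change D.toDual (PowerSeries.C (p : ℤ_[p]) • x) s = D.toDual x (p • s)
    exact D.toDual_C_natCast_smul htor x s
  obtain ⟨Ψ, -⟩ := PontryaginCard.exists_quotSMulTop_addEquiv_characterModule_ker
    (D.toDual : D.X →+ CharacterModule _) D.bijective (p : ℤ_[p]) _ hq'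
  have hle := LambdaLowerBound.pow_lambdaInvariant_le_natCard_quotient p D.X
  rw [PontryaginCard.natCard_eq_of_addEquiv_characterModule Ψ, ← SetLike.coe_sort_coe, coe_ker_toAddMonoidHom_eq] at hle
  exact hle

/-- **E1 ⟸ THE RESIDUAL COUNT (the `Λ`-algebra half of E1, once and for all).** If `M` is `p`-primary with open stabilisers, `γ` topologically
generates `Γ = Gal(K_∞/K)`, and the `p`-torsion of `Sel^{ε,S₀}_R(K_∞, M)` is finite with at most `p^N` elements, then for EVERY saturated signed
transport dual datum `Dψ`: `Dψ.X` is finitely generated and torsion over `Λ = ℤ_p⟦T⟧` and `λ(Dψ.X) ≤ N`. With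
`N = [F:ℚ_p]·(λ(X^ε_W) + Σ_{v∈S₀} δ_W^{(v)})` this is conjunct E1 of `stub_charRoad_ns` MODULO the residual count; the count is the research
residue (Shapiro transport of residual signed Selmer groups; B. D. Kim control; Greenberg–Vatsal). [cite: GreenbergLNM1716, §1 p. 60, §4 p. 98]
[cite: GreenbergVatsal2000, §2 Prop. (2.8)] [cite: Washington1997, §13.2] -/
theorem finite_torsion_lambda_le_of_card_pTorsion_le (D : SignedTransportDualDataSat κ γ M R V j S₀ ε)
    (htor : ∀ m : M, ∃ k : ℕ, p ^ k • m = 0)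
    (hstab : ∀ m : M, IsOpen (MulAction.stabilizer (absoluteGaloisGroup K) m : Set (absoluteGaloisGroup K)))
    (hγ : κ.IsTopGenerator γ) {N : ℕ}
    (hfin : {s : signedTransportSelmerInftySat κ M R V j S₀ ε | p • s = 0}.Finite)
    (hcard : Nat.card {s : signedTransportSelmerInftySat κ M R V j S₀ ε | p • s = 0} ≤ p ^ N) :
    Module.Finite (IwasawaAlgebra p) D.X ∧ Module.IsTorsion (IwasawaAlgebra p) D.X ∧ lambdaInvariant p D.X ≤ N :=
  ⟨D.moduleFinite_of_finite_pTorsion htor hstab hγ hfin, D.isTorsion_of_finite_pTorsion htor hstab hγ hfin,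
    (Nat.pow_le_pow_iff_right (Fact.out : p.Prime).one_lt).mp
      ((D.pow_lambdaInvariant_le_card_pTorsion htor hstab hγ hfin).trans hcard)⟩

end SignedTransportDualDataSat

end Summit.BirchSwinnertonDyer.BirchSwinnertonDyer.Theorems.SmallImageCharSignedSelmer

end
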